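import Summits.AtomisticToContinuum.BoseEinsteinCondensation.Theses.BECDeletionChiSquare
import Summits.AtomisticToContinuum.BoseEinsteinCondensation.Theses.BECCutLineWeakDisorder
import Literature.MathematicalPhysics.QuantumManyBody.MeanSelfDensity
import Literature.MathematicalPhysics.QuantumManyBody.GroundStateFeynmanKacCutLine

/-!
# Crux `ChiSquareTolerance` (stmt-11937) vs the sibling route `BECCutLineWeakDisorder`:
# the chi-square functional DOMINATES the landscape functional (kernel-checked comparison)

Strategist workfile (crux-strategist seat, 2026-08-17). Slice Hölder with exponents `(2/3, 1/3)`: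
for every measurable `g ≥ 0` on `ℝ³`, `(∫ g²)³ ≤ (∫ g)² · ∫ g⁴`, hence for every slice with
`b(Y) = ∫|Ψ(x,Y)|² < ∞`:

  `L³ · b(Y)² / S(Y)²  ≤  L³ · ∫ |Ψ(x,Y)|⁴ dx / b(Y)`,   `S(Y) = ∫ |Ψ(x,Y)| dx`,

i.e. the integrand of `BECCutLineWeakDisorder.LandscapeBound` / `TwoReplicaTransienceBound`
(stmt-9087 / stmt-9687) is dominated by the integrand of `BECDeletionChiSquare.ChiSquareTolerance`
(stmt-11937, `BoseGas.meanSelfDensity`). Consequences proved here BY NAME: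

* `twoReplicaTransienceBound_of_fkChiSquare` — the hardest stub of line `fk_witness_transfer`
  (uniform-in-`T` chi-square bound for the FK witnesses) implies the sibling ENGINE crux
  `TwoReplicaTransienceBound` (stmt-9687);
* `landscapeBound_of_chiSquareNonneg` — the chi-square clause with a nonnegative witness (the
  conclusion shape of that line's transfer stub (G')) implies the sibling HINGE crux
  `LandscapeBound` (stmt-9087).

So every proof of 11937 along nonnegative witnesses is a proof of 9087, and the analytic core of
the FK line is at least 9687: the two programmes are one (STRATEGY-CENSUS.md §Transfer/§Decomposition).
-/

namespace Summit.AtomisticToContinuum.BoseEinsteinCondensation.Cruxes.ChiSquareTolerance.Compare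

open MeasureTheory Filter
open scoped ENNReal
open Literature.MathematicalPhysics.QuantumManyBody.BoseGas

/-- **Slice Hölder**: `(∫ g²)³ ≤ (∫ g)² · ∫ g⁴` for a.e.-measurable `g ≥ 0` (Hölder with the
exponents `2/3 + 1/3 = 1` applied to `g² = g^{2/3} · (g⁴)^{1/3}`). -/
theorem lintegral_sq_pow_three_le {α : Type*} [MeasurableSpace α] (μ : Measure α) {g : α → ℝ≥0∞}
    (hg : AEMeasurable g μ) :
    (∫⁻ a, g a ^ 2 ∂μ) ^ 3 ≤ (∫⁻ a, g a ∂μ) ^ 2 * ∫⁻ a, g a ^ 4 ∂μ := by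
  have h := ENNReal.lintegral_mul_norm_pow_le (μ := μ) (f := g) (g := fun a => g a ^ 4) hg
    (hg.pow_const 4) (p := 2 / 3) (q := 1 / 3) (by norm_num) (by norm_num) (by norm_num)
  have hpt : ∀ a, g a ^ (2 / 3 : ℝ) * (g a ^ 4) ^ (1 / 3 : ℝ) = g a ^ 2 := by
    intro a
    rw [show (g a ^ 4) = g a ^ ((4 : ℕ) : ℝ) from (ENNReal.rpow_natCast (g a) 4).symm,
      ← ENNReal.rpow_mul, ← ENNReal.rpow_add_of_nonneg _ _ (by norm_num) (by norm_num),
      show ((2 / 3 : ℝ) + ((4 : ℕ) : ℝ) * (1 / 3)) = ((2 : ℕ) : ℝ) by norm_num,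
      ENNReal.rpow_natCast]
  simp_rw [hpt] at h
  calc (∫⁻ a, g a ^ 2 ∂μ) ^ 3
      ≤ ((∫⁻ a, g a ∂μ) ^ (2 / 3 : ℝ) * (∫⁻ a, g a ^ 4 ∂μ) ^ (1 / 3 : ℝ)) ^ 3 := by
        gcongr
    _ = (∫⁻ a, g a ∂μ) ^ 2 * ∫⁻ a, g a ^ 4 ∂μ := by
        rw [mul_pow, ← ENNReal.rpow_natCast (_ ^ (2 / 3 : ℝ)) 3,
          ← ENNReal.rpow_natCast (_ ^ (1 / 3 : ℝ)) 3, ← ENNReal.rpow_mul, ← ENNReal.rpow_mul,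
          show ((2 / 3 : ℝ) * ((3 : ℕ) : ℝ)) = ((2 : ℕ) : ℝ) by norm_num,
          show ((1 / 3 : ℝ) * ((3 : ℕ) : ℝ)) = (1 : ℝ) by norm_num,
          ENNReal.rpow_natCast, ENNReal.rpow_one]

/-- **Pointwise domination of the landscape integrand by the chi-square integrand.** With
`b = ∫ g²`, `S = ∫ g`, `A = ∫ g⁴` and `b ≠ ⊤`: `c · b² / S² ≤ c · (A / b)` for every constant `c`
(here `c = L³`). Junk cases: `b = 0` gives `0 ≤ …`; `S = ⊤` gives `0 ≤ …`; `S = 0` forces `b = 0`. -/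
theorem landscapeIntegrand_le {α : Type*} [MeasurableSpace α] (μ : Measure α) {g : α → ℝ≥0∞}
    (hg : AEMeasurable g μ) (hb : ∫⁻ a, g a ^ 2 ∂μ ≠ ⊤) (c : ℝ≥0∞) :
    c * (∫⁻ a, g a ^ 2 ∂μ) ^ 2 / (∫⁻ a, g a ∂μ) ^ 2 ≤ c * ((∫⁻ a, g a ^ 4 ∂μ) / ∫⁻ a, g a ^ 2 ∂μ) := by
  set b := ∫⁻ a, g a ^ 2 ∂μ with hbdef
  set S := ∫⁻ a, g a ∂μ with hSdef
  set A := ∫⁻ a, g a ^ 4 ∂μ with hAdef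
  rcases eq_or_ne b 0 with hb0 | hb0
  · simp [hb0]
  have hS0 : S ≠ 0 := by
    intro hS0
    apply hb0
    have hg0 : g =ᵐ[μ] 0 := (lintegral_eq_zero_iff' hg).1 hS0
    have h2 : (fun a => g a ^ 2) =ᵐ[μ] fun _ => 0 := hg0.mono fun a ha => by simp [ha]
    rw [hbdef, lintegral_congr_ae h2, lintegral_zero]
  rcases eq_or_ne S ⊤ with hStop | hStop
  · have : c * b ^ 2 / S ^ 2 = 0 := by simp [hStop, ENNReal.div_top]
    rw [this]
    exact bot_le
  -- `b² / S² ≤ A / b` from `b³ ≤ S² A`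
  have h3 : b ^ 3 ≤ S ^ 2 * A := lintegral_sq_pow_three_le μ hg
  have key : b ^ 2 / S ^ 2 ≤ A / b := by
    apply ENNReal.div_le_of_le_mul
    calc b ^ 2 = b ^ 2 * b / b := by rw [ENNReal.mul_div_cancel_right hb0 hb]
      _ = b ^ 3 / b := by rw [← pow_succ]
      _ ≤ S ^ 2 * A / b := ENNReal.div_le_div_right h3 b
      _ = A / b * S ^ 2 := by rw [mul_div_assoc, mul_comm]
  rw [mul_div_assoc]
  exact mul_le_mul' le_rfl key

/-- **The landscape functional is dominated by the mean self-conditional density**: for measurable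
`Ψ` with `∫ |Ψ|² < ∞` (so that a.e. slice is in `L²`),
`∫_Y L³ b(Y)²/S(Y)² ≤ m₂(Ψ) = L³ ∫_Y ∫_x |Ψ(x,Y)|⁴ / b(Y)`. -/
theorem landscape_le_meanSelfDensity (n : ℕ) (L : ℝ) {Ψ : Config (n + 1) → ℂ} (hΨ : Measurable Ψ)
    (h2 : ∫⁻ X, (‖Ψ X‖₊ : ℝ≥0∞) ^ 2 ≠ ⊤) :
    ∫⁻ Y : Config n, ENNReal.ofReal (L ^ 3) *
        (∫⁻ x, (‖Ψ (Matrix.vecCons x Y)‖₊ : ℝ≥0∞) ^ 2) ^ 2 /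
          (∫⁻ x, (‖Ψ (Matrix.vecCons x Y)‖₊ : ℝ≥0∞)) ^ 2 ≤ meanSelfDensity n L Ψ := by
  have hNm : Measurable fun X => (‖Ψ X‖₊ : ℝ≥0∞) := hΨ.nnnorm.coe_nnreal_ennreal
  have hbm : Measurable fun Y : Config n => ∫⁻ x : Space, (‖Ψ (Matrix.vecCons x Y)‖₊ : ℝ≥0∞) ^ 2 :=
    measurable_lintegral_vecCons (hNm.pow_const 2)
  have hbb : ∫⁻ Y : Config n, ∫⁻ x : Space, (‖Ψ (Matrix.vecCons x Y)‖₊ : ℝ≥0∞) ^ 2 ≠ ⊤ := by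
    rwa [← lintegral_eq_lintegral_lintegral_vecCons (hNm.pow_const 2)]
  have hfin : ∀ᵐ Y : Config n, ∫⁻ x : Space, (‖Ψ (Matrix.vecCons x Y)‖₊ : ℝ≥0∞) ^ 2 < ⊤ :=
    ae_lt_top hbm hbb
  rw [meanSelfDensity, ← lintegral_const_mul' _ _ ENNReal.ofReal_ne_top]
  refine lintegral_mono_ae (hfin.mono fun Y hY => ?_)
  have hgx : AEMeasurable (fun x : Space => (‖Ψ (Matrix.vecCons x Y)‖₊ : ℝ≥0∞)) volume :=
    (hNm.comp (measurable_vecCons_left Y)).aemeasurable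
  have h4m : Measurable fun x : Space => (‖Ψ (Matrix.vecCons x Y)‖₊ : ℝ≥0∞) ^ 4 :=
    (hNm.pow_const 4).comp (measurable_vecCons_left Y)
  have hdiv : ∫⁻ x : Space, (‖Ψ (Matrix.vecCons x Y)‖₊ : ℝ≥0∞) ^ 4 /
      ∫⁻ x' : Space, (‖Ψ (Matrix.vecCons x' Y)‖₊ : ℝ≥0∞) ^ 2 =
        (∫⁻ x : Space, (‖Ψ (Matrix.vecCons x Y)‖₊ : ℝ≥0∞) ^ 4) /
          ∫⁻ x' : Space, (‖Ψ (Matrix.vecCons x' Y)‖₊ : ℝ≥0∞) ^ 2 := by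
    simp only [div_eq_mul_inv]
    rw [lintegral_mul_const _ h4m]
  rw [hdiv]
  exact landscapeIntegrand_le volume hgx hY.ne _

/-! ### Consequences by name -/

/-- `‖(r : ℂ)‖₊ = ‖r‖₊` bookkeeping: the chi-square functional of the complexified witness. -/
theorem nnnorm_ofReal' (r : ℝ) : (‖(r : ℂ)‖₊ : ℝ≥0∞) = (‖r‖₊ : ℝ≥0∞) := by
  rw [Complex.nnnorm_real]

/-- The FK witness has `∫ Ψ_T² < ∞` (it is `1` when `0 < ‖e^{-TH}1‖₂ < ∞`, and `Ψ_T ≡ 0` in the junk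
branches). -/
theorem lintegral_fkWitness_nnnorm_sq_ne_top {N : ℕ} {v : ℝ → ℝ≥0∞} (hv : Measurable v) (L T : ℝ) :
    ∫⁻ X, (‖(fkWitness (N := N) v L T (fun _ => (1 : ℝ≥0∞)) X : ℂ)‖₊ : ℝ≥0∞) ^ 2 ≠ ⊤ := by
  have hconv : ∀ X, (‖(fkWitness (N := N) v L T (fun _ => (1 : ℝ≥0∞)) X : ℂ)‖₊ : ℝ≥0∞) ^ 2 =
      ENNReal.ofReal (fkWitness (N := N) v L T (fun _ => (1 : ℝ≥0∞)) X) ^ 2 := by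
    intro X
    rw [nnnorm_ofReal', ← enorm_eq_nnnorm, Real.enorm_eq_ofReal (fkWitness_nonneg v L T _ X)]
  simp_rw [hconv]
  by_cases h0 : fkNormSq (N := N) v L T (fun _ => 1) = 0
  · have : ∀ X, fkWitness (N := N) v L T (fun _ => (1 : ℝ≥0∞)) X = 0 := fun X => by
      simp [fkWitness_apply, h0]
    simp [this]
  by_cases htop : fkNormSq (N := N) v L T (fun _ => 1) = ⊤
  · have : ∀ X, fkWitness (N := N) v L T (fun _ => (1 : ℝ≥0∞)) X = 0 := fun X => by
      simp [fkWitness_apply, htop]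
    simp [this]
  rw [lintegral_fkWitness_sq hv L T measurable_const h0 htop]
  exact ENNReal.one_ne_top

/-- **The FK chi-square bound implies the sibling engine crux `TwoReplicaTransienceBound`
(stmt-9687) by name.** Hypothesis = verbatim the statement of `stub_fkChiSquareBound` of line
`fk_witness_transfer` (uniform-in-`T` bound on `m₂` of the complexified FK witness). -/
theorem twoReplicaTransienceBound_of_fkChiSquare
    (h : ∀ v : ℝ → ℝ≥0∞, IsRepulsiveFiniteRange v →
      ∃ ρ₀ : ℝ, 0 < ρ₀ ∧ ∀ ρ : ℝ, 0 < ρ → ρ < ρ₀ → ∃ C : ℝ, 0 < C ∧ ∀ᶠ n : ℕ in atTop,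
        ∀ T : ℝ, 1 ≤ T →
          meanSelfDensity n (sideLength ρ (n + 1))
              (fun X => (fkWitness (N := n + 1) v (sideLength ρ (n + 1)) T
                (fun _ => (1 : ℝ≥0∞)) X : ℂ)) ≤ ENNReal.ofReal C) :
    Summit.AtomisticToContinuum.BoseEinsteinCondensation.Theses.BECCutLineWeakDisorder.TwoReplicaTransienceBound := by
  intro v hv
  obtain ⟨ρ₀, hρ₀, H⟩ := h v hv
  refine ⟨ρ₀, hρ₀, fun ρ hρ hρlt => ?_⟩
  obtain ⟨C, hC, hev⟩ := H ρ hρ hρlt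
  refine ⟨C, hC, ?_⟩
  filter_upwards [hev] with n hn T hT
  have hm : Measurable fun X => (fkWitness (N := n + 1) v (sideLength ρ (n + 1)) T
      (fun _ => (1 : ℝ≥0∞)) X : ℂ) :=
    Complex.measurable_ofReal.comp (measurable_fkWitness hv.1 _ T measurable_const)
  have key := landscape_le_meanSelfDensity n (sideLength ρ (n + 1)) hm
    (lintegral_fkWitness_nnnorm_sq_ne_top hv.1 _ T)
  refine le_trans (le_of_eq ?_) (key.trans (hn T hT))
  simp only [nnnorm_ofReal']

/-- **The chi-square clause with a NONNEGATIVE witness implies the sibling hinge crux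
`LandscapeBound` (stmt-9087) by name** (same witness, same constant). The hypothesis is the
conclusion shape of the transfer stub (G') of line `fk_witness_transfer`, quantified over `v`. -/
theorem landscapeBound_of_chiSquareNonneg
    (h : ∀ v : ℝ → ℝ≥0∞, IsRepulsiveFiniteRange v →
      ∃ ρ₀ : ℝ, 0 < ρ₀ ∧ ∀ ρ : ℝ, 0 < ρ → ρ < ρ₀ → ∃ C : ℝ, 0 < C ∧ ∀ᶠ n : ℕ in atTop,
        ∀ δ : ℝ≥0∞, 0 < δ →
          ∃ Ψ : TrialState (n + 1) (sideLength ρ (n + 1)),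
            energy v Ψ ≤ groundStateEnergy v (n + 1) (sideLength ρ (n + 1)) + δ ∧
              (∀ X, Ψ.ψ X = (‖Ψ.ψ X‖ : ℂ)) ∧
                meanSelfDensity n (sideLength ρ (n + 1)) Ψ.ψ ≤ ENNReal.ofReal C) :
    Summit.AtomisticToContinuum.BoseEinsteinCondensation.Theses.BECCutLineWeakDisorder.LandscapeBound := by
  intro v hv
  obtain ⟨ρ₀, hρ₀, H⟩ := h v hv
  refine ⟨ρ₀, hρ₀, fun ρ hρ hρlt => ?_⟩
  obtain ⟨C, hC, hev⟩ := H ρ hρ hρlt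
  refine ⟨C, hC, ?_⟩
  filter_upwards [hev] with n hn δ hδ
  obtain ⟨Ψ, hE, hnn, hm⟩ := hn δ hδ
  refine ⟨Ψ, hE, hnn, ?_⟩
  have h2 : ∫⁻ X, (‖Ψ.ψ X‖₊ : ℝ≥0∞) ^ 2 ≠ ⊤ := by rw [Ψ.norm_eq]; exact ENNReal.one_ne_top
  exact (landscape_le_meanSelfDensity n _ Ψ.contDiff.continuous.measurable h2).trans hm

end Summit.AtomisticToContinuum.BoseEinsteinCondensation.Cruxes.ChiSquareTolerance.Compare
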